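import Mathlib.Analysis.Fourier.Convolution
import Mathlib.Analysis.Calculus.ContDiff.Convolution
import Mathlib.Analysis.Fourier.Inversion
import Mathlib.Analysis.Distribution.SchwartzSpace.Fourier
import Mathlib.Analysis.Distribution.AEEqOfIntegralContDiff
import Mathlib.Analysis.Calculus.BumpFunction.InnerProduct
import Mathlib.Analysis.Calculus.BumpFunction.Normed
import Mathlib.MeasureTheory.Integral.Asymptotics
import Mathlib.Analysis.SpecialFunctions.ImproperIntegrals
import Literature.NumberTheory.LFunctions.SalemIntegralEquationProofs
import HarnessLib

/-!
# RH-EQUIVALENT · Salem's integral-equation criterion PROVED as an equivalence (`Salem1953_criterion_holds`): under RH the only bounded solutions of `∫ e^{−σy}φ(y)dy/(e^{e^{x−y}}+1) = 0` (`1/2 < σ < 1`) are trivial — nothing here bears on the truth of RH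

Literature-typing tranche `rh-lit-broughan-2` (Broughan, *Equivalents of the Riemann Hypothesis*,
Vol. 2, Ch. 8 "Integral Equations", §8.4 "Salem's Equation", pp. 139–142). THEOREMS only (no
definition, no named fact). DISCHARGE of the named fact
`Literature.NumberTheory.LFunctions.Salem1953_criterion` (`SalemLevinsonIntegralEquations.lean`):

  **`Salem1953_criterion_holds`** : `RiemannHypothesis ↔ ∀ σ ∈ (1/2, 1), every bounded measurable
  solution φ of ∫_ℝ e^{−σy} φ(y) dy/(e^{e^{x−y}}+1) = 0 (all x) is 0 a.e.`

The half "⟸" is the tree's `Salem1953_criterion.mpr_holds` (`SalemIntegralEquationProofs.lean`: a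
zero `ζ(σ+iτ) = 0` gives the bounded solution `e^{−iτy}`). This file PROVES the half "⟹"
(`Salem1953_criterion.mp_holds`), which in the sources is "derived from a theorem of Wiener on
Fourier transforms" (MR 14,727a): writing the equation as the convolution equation
`(k ⋆ φ)(x) = 0` with `k(u) = e^{σu}/(e^{e^u}+1) ∈ L¹(ℝ)`, whose Fourier transform is
`𝓕k(ξ) = Γ(s)(1 − 2^{1−s})ζ(s)` at `s = σ − 2πiξ` (Patkowski's change of variables in
`∫₀^∞ v^{s−1}dv/(e^v+1) = Γ(s)(1−2^{1−s})ζ(s)`, the tree's `mellin_fermiDirac_eq` /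
`integral_salemKernel_mul_exp`), RH makes `𝓕k` zero-free on `ℝ` for `1/2 < σ < 1`, and Wiener's
theorem (translates of `k` span `L¹` ⟺ `𝓕k` has no real zero) forces `φ = 0`.

LINE 1 — LABEL: RH-EQUIVALENT literature (a kernel proof of a printed RH-equivalence AS an
equivalence). WHAT THIS IS NOT: not a route, not progress toward RH; nothing here bears on the
truth of RH.

## The road taken for the Wiener step (a deviation in method, recorded)

Wiener's general Tauberian theorem is not in Mathlib. For THIS kernel it is not needed in full
generality: `𝓕k` is not only zero-free but smooth (it is the restriction of the holomorphic
function `Γ(s)(1−2^{1−s})ζ(s)` to the line `Re s = σ`), so the standard "division in the Fourier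
image" argument runs with band-limited Schwartz multipliers:

* §1 `k ∈ L¹ ∩ C_b(ℝ)` and Salem's equation is `∫ k(x − y) φ(y) dy = 0` for all `x`
  (`integral_salemK_sub_mul_eq_zero`);
* §2 `fourier_salemK`: `𝓕k(ξ) = Γ(s)(1−2^{1−s})ζ(s)`, `s = σ − 2πξi`; `contDiff_fourier_salemK`
  (smooth); `fourier_salemK_ne_zero` (zero-free under RH for `1/2 < σ < 1`: `Γ ≠ 0`, `|2^{1−s}| =
  2^{1−σ} > 1`, and `ζ(s) ≠ 0` by `quasiRiemannHypothesis_one_half_iff_holds`);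
* §3 `integral_fourierInv_sub_mul_eq_zero` (THE WIENER STEP, band-limited form): for every smooth
  compactly supported `ψ`, with `h = 𝓕⁻(ψ/𝓕k) ∈ 𝒮(ℝ)` the function `G = h ⋆ k` is continuous,
  integrable and has `𝓕G = 𝓕h · 𝓕k = ψ` (Mathlib's convolution theorem
  `Real.fourier_mul_convolution_eq`), hence `G = 𝓕⁻ψ` (Fourier inversion,
  `Continuous.fourierInv_fourier_eq`); therefore `∫ (𝓕⁻ψ)(x − y) φ(y) dy =
  ∫ h(u) (∫ k((x−u) − y) φ(y) dy) du = 0` (Fubini);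
* §4 `ae_eq_zero_of_forall_bandlimited`: if `∫ (𝓕⁻ψ) φ = 0` for all such `ψ` then `φ = 0` a.e.:
  for a bump `ψ₀` (Mathlib `ContDiffBump`) and `a ∈ ℝ`, `(𝓕⁻ψ) · (𝓕⁻ψ₀)(· − a) = 𝓕⁻(ψ ⋆ ψ_a)`
  with `ψ_a(ξ) = e^{−2πiaξ}ψ₀(ξ)` again smooth of compact support, so the INTEGRABLE function
  `Φ_a = (𝓕⁻ψ₀)(· − a)·φ` satisfies `∫ (𝓕⁻ψ) Φ_a = 0` for all `ψ`; by the self-adjointness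
  `∫ 𝓕f · g = ∫ f · 𝓕g` (`VectorFourier.integral_fourierIntegral_smul_eq_flip`) the continuous
  function `𝓕⁻Φ_a` integrates to `0` against every test function, so vanishes
  (`ae_eq_zero_of_integral_contDiff_smul_eq_zero`), so `𝓕Φ_a = 0` and `Φ_a = 0` a.e. (testing
  against `θ = 𝓕(𝓕⁻θ)`, `θ ∈ C_c^∞`, Schwartz Fourier inversion); finally `(𝓕⁻ψ₀)(0) = ∫ψ₀ > 0`, so
  `𝓕⁻ψ₀ ≠ 0` on a neighbourhood of `0`, and letting `a` range over `ℚ` gives `φ = 0` a.e.;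
* §5 `Salem1953_criterion.mp_holds`, `Salem1953_criterion_holds`.

No new definitions, no new facts (D-0026); standard axioms only.

## References

* [Salem1953] R. Salem, *Sur une proposition équivalente à l'hypothèse de Riemann*, C. R. Acad.
  Sci. Paris 236 (1953) 1127–1128; MR 14,727a (E. C. Titchmarsh): "A necessary and sufficient
  condition for the Riemann hypothesis, derived from a theorem of Wiener on Fourier transforms, is
  that the integral equation … should have no bounded solution other than the trivial solution
  `φ(y) = 0`, for `1/2 < σ < 1`."
* [Patkowski2023] A. E. Patkowski, *On Salem's integral equation and related criteria*, Tsukuba J.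
  Math. 47 (2023), §2 [corpus: paper:arxiv-2003.00581 p. 4] (the change of variables).
* [Broughan2017] K. Broughan, *Equivalents of the Riemann Hypothesis*, Vol. 2, CUP 2017, §8.4
  pp. 139–142 (secondary; errata 3 Mar 2023: proof Step (3) replaced).
* N. Wiener, *Tauberian theorems*, Ann. of Math. 33 (1932) 1–100, Thm VIII (the closure-of-
  translates theorem; here replaced by the band-limited division argument above).
-/

noncomputable section

open MeasureTheory Set Filter Asymptotics Complex Real
open scoped Topology FourierTransform Convolution ContDiff

namespace Literature.NumberTheory.LFunctions

namespace SalemNecessity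

/-! ## §1 The convolution kernel `k(u) = e^{σu}/(e^{e^u}+1) = salemKernel σ 0 (−u)` -/

/-- `e^{−σy}/(e^{e^{x−y}}+1) = e^{−σx} · k(x − y)` with `k(u) = salemKernel σ 0 (−u) = e^{σu}/(e^{e^u}+1)`:
Salem's equation is the convolution equation `(k ⋆ φ)(x) = 0`. [cite: Salem1953, the integral equation (MR 14,727a)] -/
theorem salemKernel_eq_mul (σ x y : ℝ) :
    salemKernel σ x y = Real.exp (-σ * x) * salemKernel σ 0 (-(x - y)) := by
  simp only [salemKernel, zero_sub, neg_neg]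
  rw [← mul_div_assoc, ← Real.exp_add]
  congr 1
  ring_nf

/-- `k(u) ≤ e^{σu}`. [cite: Salem1953, the integral equation (the kernel)] -/
theorem salemKernel_zero_neg_le_exp (σ u : ℝ) : salemKernel σ 0 (-u) ≤ Real.exp (σ * u) := by
  simp only [salemKernel, zero_sub, neg_neg]
  rw [show -σ * -u = σ * u by ring]
  exact div_le_self (Real.exp_pos _).le (by linarith [Real.exp_pos (Real.exp u)])

/-- `k(u) ≤ e^{(σ−1)u}` (since `e^{e^u} ≥ e^u`). [cite: Salem1953, the integral equation (the kernel)] -/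
theorem salemKernel_zero_neg_le_exp' (σ u : ℝ) : salemKernel σ 0 (-u) ≤ Real.exp ((σ - 1) * u) := by
  simp only [salemKernel, zero_sub, neg_neg]
  rw [show -σ * -u = σ * u by ring]
  have h1 : Real.exp u ≤ Real.exp (Real.exp u) + 1 := by
    have := Real.exp_le_exp.2 (by linarith [Real.add_one_le_exp u] : u ≤ Real.exp u)
    linarith
  calc Real.exp (σ * u) / (Real.exp (Real.exp u) + 1)
      ≤ Real.exp (σ * u) / Real.exp u := div_le_div_of_nonneg_left (Real.exp_pos _).le (Real.exp_pos u) h1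
    _ = Real.exp ((σ - 1) * u) := by rw [← Real.exp_sub]; ring_nf

/-- `k` is continuous. [cite: Salem1953, the integral equation (the kernel)] -/
theorem continuous_salemK (σ : ℝ) : Continuous fun u : ℝ ↦ (salemKernel σ 0 (-u) : ℂ) := by
  refine continuous_ofReal.comp ?_
  simp only [salemKernel]
  exact Continuous.div (by fun_prop) (by fun_prop) fun u ↦ by positivity

/-- `k ∈ L¹(ℝ)` for `0 < σ < 1`. [cite: Salem1953, the integral equation (the kernel)] -/
theorem integrable_salemK {σ : ℝ} (hσ : 0 < σ) (hσ1 : σ < 1) :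
    Integrable fun u : ℝ ↦ (salemKernel σ 0 (-u) : ℂ) := by
  have hn : ∀ u : ℝ, ‖(salemKernel σ 0 (-u) : ℂ)‖ = salemKernel σ 0 (-u) := fun u ↦ by
    rw [Complex.norm_real, Real.norm_of_nonneg (salemKernel_pos σ 0 (-u)).le]
  refine (continuous_salemK σ).locallyIntegrable.integrable_of_isBigO_atBot_atTop
    (g := fun u ↦ Real.exp (σ * u)) (g' := fun u ↦ Real.exp ((σ - 1) * u)) ?_ ?_ ?_ ?_
  · refine IsBigO.of_bound 1 (Eventually.of_forall fun u ↦ ?_)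
    rw [hn, one_mul, Real.norm_of_nonneg (Real.exp_pos _).le]
    exact salemKernel_zero_neg_le_exp σ u
  · exact ⟨Iic 0, Iic_mem_atBot 0, integrableOn_exp_mul_Iic hσ 0⟩
  · refine IsBigO.of_bound 1 (Eventually.of_forall fun u ↦ ?_)
    rw [hn, one_mul, Real.norm_of_nonneg (Real.exp_pos _).le]
    exact salemKernel_zero_neg_le_exp' σ u
  · exact ⟨Ioi 0, Ioi_mem_atTop 0, integrableOn_exp_mul_Ioi (by linarith) 0⟩

/-- `k(u) ≤ 1` for `0 ≤ σ ≤ 1` (`σu ≤ max(u, 0) ≤ e^u`). [cite: Salem1953, the integral equation (the kernel)] -/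
theorem salemKernel_zero_neg_le_one {σ : ℝ} (hσ : 0 ≤ σ) (hσ1 : σ ≤ 1) (u : ℝ) :
    salemKernel σ 0 (-u) ≤ 1 := by
  simp only [salemKernel, zero_sub, neg_neg]
  rw [show -σ * -u = σ * u by ring, div_le_one (by positivity)]
  have hu : σ * u ≤ Real.exp u := by
    rcases le_or_gt 0 u with h | h
    · calc σ * u ≤ 1 * u := by gcongr
        _ ≤ Real.exp u := by linarith [Real.add_one_le_exp u]
    · have : σ * u ≤ 0 := mul_nonpos_of_nonneg_of_nonpos hσ h.le
      linarith [Real.exp_pos u]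
  linarith [Real.exp_le_exp.2 hu]

/-- A Salem solution satisfies the convolution equation `∫ k(x − y) φ(y) dy = 0` for every `x`.
[cite: Salem1953, the integral equation (MR 14,727a)] -/
theorem integral_salemK_sub_mul_eq_zero {σ : ℝ} {φ : ℝ → ℂ} (hφ : IsSalemSolution σ φ) (x : ℝ) :
    ∫ y : ℝ, (salemKernel σ 0 (-(x - y)) : ℂ) * φ y = 0 := by
  have h := hφ.2.2 x
  have heq : ∀ y : ℝ, (salemKernel σ x y : ℂ) * φ y =
      (Real.exp (-σ * x) : ℂ) * ((salemKernel σ 0 (-(x - y)) : ℂ) * φ y) := fun y ↦ by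
    rw [salemKernel_eq_mul]; push_cast; ring
  simp_rw [heq] at h
  rw [integral_const_mul] at h
  exact (mul_eq_zero.1 h).resolve_left (by exact_mod_cast (Real.exp_pos _).ne')

/-! ## §2 The Fourier transform of the kernel: `𝓕k(ξ) = Γ(s)(1 − 2^{1−s})ζ(s)`, `s = σ − 2πiξ` -/

/-- `𝓕k(ξ) = Γ(s)(1−2^{1−s})ζ(s)` at `s = σ − 2πξ i` (Patkowski's change of variables in the Mellin
transform `∫₀^∞ v^{s−1}dv/(e^v+1) = Γ(s)(1−2^{1−s})ζ(s)`). [cite: Patkowski2023, §2 (proof of Thm 1.1); Patkowski2025, (1.3)] -/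
theorem fourier_salemK {σ : ℝ} (hσ : 0 < σ) (hσ1 : σ < 1) (ξ : ℝ) :
    𝓕 (fun u : ℝ ↦ (salemKernel σ 0 (-u) : ℂ)) ξ =
      Complex.Gamma (σ + ((-(2 * π * ξ) : ℝ) : ℂ) * I) *
        ((1 - 2 ^ (1 - ((σ : ℂ) + ((-(2 * π * ξ) : ℝ) : ℂ) * I))) *
          riemannZeta (σ + ((-(2 * π * ξ) : ℝ) : ℂ) * I)) := by
  have h1 : (σ : ℂ) + ((-(2 * π * ξ) : ℝ) : ℂ) * I ≠ 1 := by
    intro h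
    have := congrArg Complex.re h
    simp at this
    linarith
  have key := integral_salemKernel_mul_exp (-(2 * π * ξ)) 0 hσ h1
  rw [ofReal_zero, mul_zero, neg_zero, Complex.exp_zero, one_mul] at key
  rw [Real.fourier_real_eq_integral_exp_smul, ← key, ← integral_neg_eq_self]
  refine integral_congr_ae (ae_of_all _ fun y ↦ ?_)
  simp only [neg_neg, smul_eq_mul, mul_comm (cexp _)]
  congr 1
  push_cast
  ring_nf

/-- `𝓕k` is smooth (it is the restriction of a holomorphic function to a line). [cite: Salem1953, «transformée de Fourier» of the kernel] -/
theorem contDiff_fourier_salemK {σ : ℝ} (hσ : 0 < σ) (hσ1 : σ < 1) :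
    ContDiff ℝ ∞ (𝓕 (fun u : ℝ ↦ (salemKernel σ 0 (-u) : ℂ))) := by
  set M : ℂ → ℂ := fun s ↦ Complex.Gamma s * ((1 - 2 ^ (1 - s)) * riemannZeta s) with hM
  set ℓ : ℝ → ℂ := fun ξ ↦ (σ : ℂ) + ((-(2 * π * ξ) : ℝ) : ℂ) * I with hℓ
  have hfun : 𝓕 (fun u : ℝ ↦ (salemKernel σ 0 (-u) : ℂ)) = fun ξ ↦ M (ℓ ξ) := by
    funext ξ
    exact fourier_salemK hσ hσ1 ξ
  rw [hfun]
  have hMd : ∀ z : ℂ, 0 < z.re → z ≠ 1 → DifferentiableAt ℂ M z := by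
    intro z hz hz1
    have hG : DifferentiableAt ℂ Complex.Gamma z := by
      refine Complex.differentiableAt_Gamma z fun m h ↦ ?_
      have h2 : z.re = -(m : ℝ) := by rw [h]; simp
      linarith [Nat.cast_nonneg (α := ℝ) m]
    have hZ : DifferentiableAt ℂ riemannZeta z := differentiableAt_riemannZeta hz1
    have hP : DifferentiableAt ℂ (fun s : ℂ ↦ (2 : ℂ) ^ (1 - s)) z :=
      DifferentiableAt.const_cpow (by fun_prop) (Or.inl two_ne_zero)
    simp only [hM]
    exact hG.mul (((differentiableAt_const _).sub hP).mul hZ)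
  have hopen : IsOpen {z : ℂ | 0 < z.re ∧ z ≠ 1} :=
    (isOpen_lt continuous_const Complex.continuous_re).inter isOpen_ne
  have hoR : ContDiff ℝ ∞ ((↑) : ℝ → ℂ) := Complex.ofRealCLM.contDiff
  have hℓd : ContDiff ℝ ∞ ℓ := by
    simp only [hℓ]
    exact contDiff_const.add ((hoR.comp (by fun_prop)).mul contDiff_const)
  refine contDiff_iff_contDiffAt.2 fun ξ ↦ ?_
  have hℓξ : ℓ ξ ∈ {z : ℂ | 0 < z.re ∧ z ≠ 1} := by
    have hre : (ℓ ξ).re = σ := by simp [hℓ]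
    refine ⟨by rw [hre]; exact hσ, fun h ↦ ?_⟩
    have := congrArg Complex.re h
    rw [hre, one_re] at this
    linarith
  have hA : AnalyticAt ℂ M (ℓ ξ) := by
    refine Complex.analyticAt_iff_eventually_differentiableAt.2 ?_
    filter_upwards [hopen.mem_nhds hℓξ] with z hz using hMd z hz.1 hz.2
  exact (hA.contDiffAt.restrict_scalars ℝ).comp ξ hℓd.contDiffAt

/-- Under RH, for `1/2 < σ < 1` the Fourier transform `𝓕k` has no real zero ("the Fourier transform of
the kernel does not vanish", the hypothesis of Wiener's theorem). [cite: Salem1953, Théorème (MR 14,727a: «derived from a theorem of Wiener on Fourier transforms»)] -/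
theorem fourier_salemK_ne_zero (hRH : RiemannHypothesis) {σ : ℝ} (hσ : 1 / 2 < σ) (hσ1 : σ < 1)
    (ξ : ℝ) : 𝓕 (fun u : ℝ ↦ (salemKernel σ 0 (-u) : ℂ)) ξ ≠ 0 := by
  rw [fourier_salemK (by linarith) hσ1 ξ]
  set s : ℂ := (σ : ℂ) + ((-(2 * π * ξ) : ℝ) : ℂ) * I with hs
  have hre : s.re = σ := by simp [hs]
  have hG : Complex.Gamma s ≠ 0 := by
    refine Complex.Gamma_ne_zero fun m h ↦ ?_
    have h2 : s.re = -(m : ℝ) := by rw [h]; simp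
    linarith [Nat.cast_nonneg (α := ℝ) m]
  have hζ : riemannZeta s ≠ 0 := fun h0 ↦
    quasiRiemannHypothesis_one_half_iff_holds.2 hRH s h0 (by rw [hre]; exact hσ)
      (by rw [hre]; exact hσ1)
  have h2 : (1 : ℂ) - 2 ^ (1 - s) ≠ 0 := by
    intro h
    have h' : (2 : ℂ) ^ (1 - s) = 1 := (sub_eq_zero.1 h).symm
    have hn : ‖(2 : ℂ) ^ (1 - s)‖ = (2 : ℝ) ^ (1 - σ) := by
      rw [show (2 : ℂ) = ((2 : ℝ) : ℂ) by norm_num, Complex.norm_cpow_eq_rpow_re_of_pos two_pos]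
      simp [hre]
    rw [h', norm_one] at hn
    have : (1 : ℝ) < (2 : ℝ) ^ (1 - σ) := Real.one_lt_rpow one_lt_two (by linarith)
    linarith
  exact mul_ne_zero hG (mul_ne_zero h2 hζ)

/-! ## §4 From `∫ (𝓕⁻ψ) φ = 0` for all band-limited `ψ` to `φ = 0` a.e. -/

/-- Self-adjointness of the Fourier transform on `ℝ`: `∫ 𝓕f · g = ∫ f · 𝓕g` for integrable `f, g`
(Mathlib's `VectorFourier.integral_fourierIntegral_smul_eq_flip`, the inner product on `ℝ` being
symmetric). [folklore] -/
private theorem integral_fourier_mul_eq {f g : ℝ → ℂ} (hf : Integrable f) (hg : Integrable g) :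
    ∫ ξ : ℝ, 𝓕 f ξ * g ξ = ∫ x : ℝ, f x * 𝓕 g x := by
  have hL : Continuous fun p : ℝ × ℝ ↦ innerₗ ℝ p.1 p.2 := by
    simp only [innerₗ_apply_apply]
    exact continuous_inner
  have h := VectorFourier.integral_fourierIntegral_smul_eq_flip (L := innerₗ ℝ) (μ := volume)
    (ν := volume) Real.continuous_fourierChar hL hf hg
  have hflip : (innerₗ ℝ).flip = innerₗ ℝ := by
    ext
    simp
  rw [hflip] at h
  show ∫ ξ : ℝ, VectorFourier.fourierIntegral 𝐞 volume (innerₗ ℝ) f ξ * g ξ =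
    ∫ x : ℝ, f x * VectorFourier.fourierIntegral 𝐞 volume (innerₗ ℝ) g x
  simpa only [smul_eq_mul] using h

/-- The Fourier transform of an integrable function on `ℝ` is continuous. [folklore] -/
private theorem continuous_fourier {f : ℝ → ℂ} (hf : Integrable f) : Continuous (𝓕 f) :=
  VectorFourier.fourierIntegral_continuous Real.continuous_fourierChar
    (by simp only [innerₗ_apply_apply]; exact continuous_inner) hf

/-- The inverse Fourier transform of an integrable function on `ℝ` is continuous. [folklore] -/
private theorem continuous_fourierInv {f : ℝ → ℂ} (hf : Integrable f) : Continuous (𝓕⁻ f) := by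
  rw [Real.fourierInv_eq_fourier_comp_neg]
  exact continuous_fourier hf.comp_neg

/-- A smooth compactly supported function is integrable; its inverse Fourier transform is a Schwartz
function, in particular integrable and continuous, with `𝓕 (𝓕⁻ ψ) = ψ`. [folklore] -/
private theorem fourierInv_props {ψ : ℝ → ℂ} (hψ : ContDiff ℝ ∞ ψ) (hψc : HasCompactSupport ψ) :
    Integrable ψ ∧ Integrable (𝓕⁻ ψ) ∧ Continuous (𝓕⁻ ψ) ∧ 𝓕 (𝓕⁻ ψ) = ψ := by
  have hψi : Integrable ψ := hψ.continuous.integrable_of_hasCompactSupport hψc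
  set Ψ : SchwartzMap ℝ ℂ := hψc.toSchwartzMap hψ with hΨ
  have hcoe : (Ψ : ℝ → ℂ) = ψ := rfl
  have h1 : ((𝓕⁻ Ψ : SchwartzMap ℝ ℂ) : ℝ → ℂ) = 𝓕⁻ ψ := by
    rw [SchwartzMap.fourierInv_coe, hcoe]
  refine ⟨hψi, ?_, continuous_fourierInv hψi, ?_⟩
  · rw [← h1]
    exact (𝓕⁻ Ψ).integrable
  · have h2 : ((𝓕 (𝓕⁻ Ψ) : SchwartzMap ℝ ℂ) : ℝ → ℂ) = ψ := by
      rw [FourierTransform.fourier_fourierInv_eq, hcoe]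
    rwa [SchwartzMap.fourier_coe, h1] at h2

/-- An integrable function whose Fourier transform vanishes identically is a.e. zero (test against
`θ = 𝓕(𝓕⁻θ)`, `θ ∈ C_c^∞`, and the self-adjointness `∫ 𝓕f · g = ∫ f · 𝓕g`). [folklore] -/
private theorem ae_eq_zero_of_fourier_eq_zero {Φ : ℝ → ℂ} (hΦ : Integrable Φ)
    (h0 : ∀ ξ, 𝓕 Φ ξ = 0) : Φ =ᵐ[volume] 0 := by
  refine ae_eq_zero_of_integral_contDiff_smul_eq_zero hΦ.locallyIntegrable fun θ hθ hθc ↦ ?_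
  have hΘc : HasCompactSupport (fun x : ℝ ↦ (θ x : ℂ)) := hθc.comp_left Complex.ofReal_zero
  have hΘs : ContDiff ℝ ∞ (fun x : ℝ ↦ (θ x : ℂ)) := Complex.ofRealCLM.contDiff.comp hθ
  set Θ : SchwartzMap ℝ ℂ := hΘc.toSchwartzMap hΘs with hΘdef
  have hcoe : (Θ : ℝ → ℂ) = fun x : ℝ ↦ (θ x : ℂ) := rfl
  set χ : SchwartzMap ℝ ℂ := 𝓕⁻ Θ with hχdef
  have hχΘ : 𝓕 (χ : ℝ → ℂ) = fun x : ℝ ↦ (θ x : ℂ) := by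
    have : ((𝓕 χ : SchwartzMap ℝ ℂ) : ℝ → ℂ) = (Θ : ℝ → ℂ) := by
      rw [hχdef, FourierTransform.fourier_fourierInv_eq]
    rwa [SchwartzMap.fourier_coe, hcoe] at this
  calc ∫ x, θ x • Φ x = ∫ x, 𝓕 (χ : ℝ → ℂ) x * Φ x := by
        simp_rw [hχΘ, Complex.real_smul]
    _ = ∫ x, χ x * 𝓕 Φ x := integral_fourier_mul_eq χ.integrable hΦ
    _ = 0 := by simp [h0]

/-- If `∫ (𝓕⁻ψ) Φ = 0` for every smooth compactly supported `ψ` and `Φ ∈ L¹`, then `Φ = 0` a.e.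
(self-adjointness gives `∫ ψ · 𝓕⁻Φ = 0`, so the continuous function `𝓕⁻Φ` vanishes, hence `𝓕Φ = 0`). [folklore] -/
private theorem ae_eq_zero_of_forall_integral_fourierInv_mul {Φ : ℝ → ℂ} (hΦ : Integrable Φ)
    (h : ∀ ψ : ℝ → ℂ, ContDiff ℝ ∞ ψ → HasCompactSupport ψ → ∫ y : ℝ, 𝓕⁻ ψ y * Φ y = 0) :
    Φ =ᵐ[volume] 0 := by
  have hΦneg : Integrable (fun x : ℝ ↦ Φ (-x)) := hΦ.comp_neg
  -- Step 1: `∫ ψ · 𝓕⁻Φ = 0` for every smooth compactly supported `ψ` (self-adjointness).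
  have h1 : ∀ ψ : ℝ → ℂ, ContDiff ℝ ∞ ψ → HasCompactSupport ψ →
      ∫ ξ : ℝ, ψ ξ * 𝓕⁻ Φ ξ = 0 := by
    intro ψ hψ hψc
    have hψi : Integrable ψ := hψ.continuous.integrable_of_hasCompactSupport hψc
    have e1 : ∫ y : ℝ, 𝓕⁻ ψ y * Φ y = ∫ y : ℝ, 𝓕 ψ y * Φ (-y) := by
      rw [← integral_neg_eq_self (fun y : ℝ ↦ 𝓕 ψ y * Φ (-y))]
      refine integral_congr_ae (ae_of_all _ fun y ↦ ?_)
      simp only [neg_neg, Real.fourierInv_eq_fourier_neg]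
    have e2 : ∫ y : ℝ, 𝓕 ψ y * Φ (-y) = ∫ ξ : ℝ, ψ ξ * 𝓕 (fun x : ℝ ↦ Φ (-x)) ξ :=
      integral_fourier_mul_eq hψi hΦneg
    rw [Real.fourierInv_eq_fourier_comp_neg, ← e2, ← e1]
    exact h ψ hψ hψc
  -- Step 2: the continuous function `𝓕⁻Φ` vanishes identically.
  have hc : Continuous (𝓕⁻ Φ) := continuous_fourierInv hΦ
  have hzero : 𝓕⁻ Φ = fun _ ↦ 0 := by
    have hae : ∀ᵐ ξ : ℝ, 𝓕⁻ Φ ξ = 0 := by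
      refine ae_eq_zero_of_integral_contDiff_smul_eq_zero hc.locallyIntegrable fun θ hθ hθc ↦ ?_
      have := h1 (fun x ↦ (θ x : ℂ)) (Complex.ofRealCLM.contDiff.comp hθ)
        (hθc.comp_left Complex.ofReal_zero)
      simpa only [Complex.real_smul] using this
    exact (hc.ae_eq_iff_eq volume continuous_const).1 hae
  -- Step 3: `𝓕Φ ≡ 0`, hence `Φ = 0` a.e.
  refine ae_eq_zero_of_fourier_eq_zero hΦ fun ξ ↦ ?_
  have := congrFun hzero (-ξ)
  rwa [Real.fourierInv_eq_fourier_neg, neg_neg] at this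

/-- **Closing the Wiener step.** If `φ` is bounded measurable and `∫ (𝓕⁻ψ) φ = 0` for every smooth
compactly supported `ψ`, then `φ = 0` a.e.: for a bump `ψ₀` and `a ∈ ℝ`, `(𝓕⁻ψ)·(𝓕⁻ψ₀)(· − a)` is
again of the form `𝓕⁻(C_c^∞)`, so `Φ_a = (𝓕⁻ψ₀)(· − a) φ ∈ L¹` is a.e. zero; `𝓕⁻ψ₀ ≠ 0` near `0` and
`a` ranges over `ℚ`. [folklore] -/
private theorem ae_eq_zero_of_forall_bandlimited {φ : ℝ → ℂ} (hφm : Measurable φ)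
    (hφb : ∃ C : ℝ, ∀ y, ‖φ y‖ ≤ C)
    (h : ∀ ψ : ℝ → ℂ, ContDiff ℝ ∞ ψ → HasCompactSupport ψ → ∫ y : ℝ, 𝓕⁻ ψ y * φ y = 0) :
    φ =ᵐ[volume] 0 := by
  obtain ⟨C, hC⟩ := hφb
  have hoR : ContDiff ℝ ∞ ((↑) : ℝ → ℂ) := Complex.ofRealCLM.contDiff
  -- the bump `ψ₀` and `g₀ = 𝓕⁻ψ₀`
  let b : ContDiffBump (0 : ℝ) := default
  set ψ₀ : ℝ → ℂ := fun ξ ↦ ((b ξ : ℝ) : ℂ) with hψ₀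
  have hψ₀s : ContDiff ℝ ∞ ψ₀ := hoR.comp b.contDiff
  have hψ₀c : HasCompactSupport ψ₀ := b.hasCompactSupport.comp_left Complex.ofReal_zero
  obtain ⟨hψ₀i, hg₀i, hg₀c, -⟩ := fourierInv_props hψ₀s hψ₀c
  set g₀ : ℝ → ℂ := 𝓕⁻ ψ₀ with hg₀
  have hg₀0 : g₀ 0 ≠ 0 := by
    have h0 : g₀ 0 = ∫ ξ, ψ₀ ξ := by
      rw [hg₀, Real.fourierInv_eq]
      simp
    rw [h0, hψ₀]
    show (∫ ξ : ℝ, ((b ξ : ℝ) : ℂ)) ≠ 0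
    rw [integral_complex_ofReal]
    exact_mod_cast b.integral_pos.ne'
  -- modulated bumps `ψ_a(ξ) = e^{-2πiaξ} ψ₀(ξ)`, with `𝓕⁻ψ_a = g₀(· − a)`
  have hmod : ∀ a : ℝ, ∃ ψa : ℝ → ℂ, ContDiff ℝ ∞ ψa ∧ HasCompactSupport ψa ∧ Integrable ψa ∧
      ∀ x, 𝓕⁻ ψa x = g₀ (x - a) := by
    intro a
    have hes : ContDiff ℝ ∞ fun ξ : ℝ ↦ cexp (((-2 * π * ξ * a : ℝ) : ℂ) * I) :=
      Complex.contDiff_exp.comp ((hoR.comp (by fun_prop)).mul contDiff_const)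
    have hec : Continuous fun ξ : ℝ ↦ cexp (((-2 * π * ξ * a : ℝ) : ℂ) * I) := hes.continuous
    refine ⟨fun ξ ↦ cexp (((-2 * π * ξ * a : ℝ) : ℂ) * I) * ψ₀ ξ, hes.mul hψ₀s, hψ₀c.mul_left,
      hψ₀i.bdd_mul (c := 1) hec.aestronglyMeasurable
        (ae_of_all _ fun ξ ↦ (Complex.norm_exp_ofReal_mul_I _).le), fun x ↦ ?_⟩
    · rw [hg₀, Real.fourierInv_eq', Real.fourierInv_eq']
      refine integral_congr_ae (ae_of_all _ fun v ↦ ?_)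
      simp only [smul_eq_mul, ← mul_assoc, ← Complex.exp_add]
      congr 2
      simp only [Real.inner_apply]
      push_cast
      ring
  -- each `Φ_a = g₀(· − a) φ` is a.e. zero
  have hΦ : ∀ a : ℝ, ∀ᵐ y : ℝ, g₀ (y - a) * φ y = 0 := by
    intro a
    obtain ⟨ψa, hψas, hψac, hψai, hψaF⟩ := hmod a
    have hΦi : Integrable (fun y ↦ g₀ (y - a) * φ y) :=
      (hg₀i.comp_sub_right a).mul_bdd hφm.aestronglyMeasurable (ae_of_all _ hC)
    have hae := ae_eq_zero_of_forall_integral_fourierInv_mul hΦi fun ψ hψ hψc ↦ by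
      obtain ⟨hψi, -, -, -⟩ := fourierInv_props hψ hψc
      set ρ : ℝ → ℂ := ψ ⋆[ContinuousLinearMap.mul ℂ ℂ, volume] ψa with hρ
      have hρ' : ρ = ψ ⋆[ContinuousLinearMap.mul ℝ ℂ, volume] ψa := by
        funext x
        simp only [hρ, convolution_def, ContinuousLinearMap.mul_apply']
      have hρs : ContDiff ℝ ∞ ρ := by
        rw [hρ']
        exact hψc.contDiff_convolution_left (ContinuousLinearMap.mul ℝ ℂ) hψ hψai.locallyIntegrable
      have hρc : HasCompactSupport ρ := hψc.convolution (ContinuousLinearMap.mul ℂ ℂ) hψac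
      have hρF : ∀ y, 𝓕⁻ ρ y = 𝓕⁻ ψ y * g₀ (y - a) := by
        intro y
        rw [Real.fourierInv_eq_fourier_neg, hρ, Real.fourier_mul_convolution_eq hψi hψai,
          ← Real.fourierInv_eq_fourier_neg, ← Real.fourierInv_eq_fourier_neg, hψaF]
      have := h ρ hρs hρc
      simp_rw [hρF, mul_assoc] at this
      exact this
    filter_upwards [hae] with y hy
    simpa using hy
  -- `g₀ ≠ 0` near `0`, and rational translates
  obtain ⟨δ, hδ, hball⟩ : ∃ δ > 0, ∀ x : ℝ, |x| < δ → g₀ x ≠ 0 := by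
    have hopen : IsOpen {x : ℝ | g₀ x ≠ 0} := isOpen_ne_fun hg₀c continuous_const
    obtain ⟨δ, hδ, hsub⟩ := Metric.isOpen_iff.1 hopen 0 hg₀0
    exact ⟨δ, hδ, fun x hx ↦ hsub (by simpa [Real.dist_eq] using hx)⟩
  have hall : ∀ᵐ y : ℝ, ∀ q : ℚ, g₀ (y - q) * φ y = 0 := ae_all_iff.2 fun q ↦ hΦ q
  filter_upwards [hall] with y hy
  obtain ⟨q, hq1, hq2⟩ := exists_rat_btwn (show y - δ < y + δ by linarith)
  have hq : |y - (q : ℝ)| < δ := abs_sub_lt_iff.2 ⟨by linarith, by linarith⟩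
  exact (mul_eq_zero.1 (hy q)).resolve_left (hball _ hq)

/-! ## §3 The Wiener step for band-limited multipliers -/

/-- **Wiener's step, band-limited form.** If `k ∈ L¹ ∩ C_b` has a smooth zero-free Fourier transform and
`∫ k(x−y)φ(y)dy = 0` for all `x` (`φ` bounded measurable), then `∫ (𝓕⁻ψ)(x − y) φ(y) dy = 0` for every
smooth compactly supported `ψ` and every `x`: with `h = 𝓕⁻(ψ/𝓕k) ∈ 𝒮` one has `h ⋆ k = 𝓕⁻ψ`
(convolution theorem and Fourier inversion), so the integral is `∫ h(u) (∫ k(x−u−y)φ(y)dy) du = 0`.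
[cite: Salem1953, Théorème (the Wiener step); Broughan2017, Vol. 2 §8.4] -/
theorem integral_fourierInv_sub_mul_eq_zero {k : ℝ → ℂ} (hk : Integrable k) (hkc : Continuous k)
    (hkb : ∃ B : ℝ, ∀ u, ‖k u‖ ≤ B) (hks : ContDiff ℝ ∞ (𝓕 k)) (hk0 : ∀ ξ, 𝓕 k ξ ≠ 0)
    {φ : ℝ → ℂ} (hφm : Measurable φ) (hφb : ∃ C : ℝ, ∀ y, ‖φ y‖ ≤ C)
    (hφ : ∀ x : ℝ, ∫ y : ℝ, k (x - y) * φ y = 0)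
    {ψ : ℝ → ℂ} (hψ : ContDiff ℝ ∞ ψ) (hψc : HasCompactSupport ψ) (x : ℝ) :
    ∫ y : ℝ, 𝓕⁻ ψ (x - y) * φ y = 0 := by
  obtain ⟨B, hB⟩ := hkb
  obtain ⟨C, hC⟩ := hφb
  -- the multiplier `q = ψ/𝓕k ∈ C_c^∞` and `h = 𝓕⁻q ∈ 𝒮`
  set q : ℝ → ℂ := fun ξ ↦ ψ ξ / 𝓕 k ξ with hq
  have hqs : ContDiff ℝ ∞ q := by
    show ContDiff ℝ ∞ (fun ξ ↦ ψ ξ * (𝓕 k ξ)⁻¹)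
    exact hψ.mul (hks.inv hk0)
  have hqc : HasCompactSupport q := by
    show HasCompactSupport (fun ξ ↦ ψ ξ * (𝓕 k ξ)⁻¹)
    exact hψc.mul_right
  obtain ⟨-, hhi, -, hFh⟩ := fourierInv_props hqs hqc
  obtain ⟨hψi, -, -, -⟩ := fourierInv_props hψ hψc
  set h : ℝ → ℂ := 𝓕⁻ q with hh
  -- `G = h ⋆ k` is continuous, integrable, with `𝓕G = 𝓕h · 𝓕k = ψ`
  set G : ℝ → ℂ := h ⋆[ContinuousLinearMap.mul ℂ ℂ, volume] k with hG
  have hGi : Integrable G := hhi.integrable_convolution (ContinuousLinearMap.mul ℂ ℂ) hk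
  have hGc : Continuous G := by
    refine BddAbove.continuous_convolution_right_of_integrable (ContinuousLinearMap.mul ℂ ℂ) ?_ hhi
      hkc
    exact ⟨B, by rintro _ ⟨u, rfl⟩; exact hB u⟩
  have hFG : 𝓕 G = ψ := by
    funext ξ
    rw [hG, Real.fourier_mul_convolution_eq hhi hk, hFh, hq]
    exact div_mul_cancel₀ _ (hk0 ξ)
  -- hence `G = 𝓕⁻ψ` (Fourier inversion for the continuous integrable `G`)
  have hGg : G = 𝓕⁻ ψ := by
    have h1 := hGc.fourierInv_fourier_eq hGi (by rw [hFG]; exact hψi)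
    rw [hFG] at h1
    exact h1.symm
  rw [← hGg]
  -- `∫ G(x − y) φ(y) dy = ∫∫ h(u) k(z − u) φ(x − z) du dz`
  have e1 : ∫ y, G (x - y) * φ y = ∫ z, G z * φ (x - z) := by
    rw [← integral_sub_left_eq_self (fun z ↦ G z * φ (x - z)) volume x]
    simp only [sub_sub_cancel]
  rw [e1]
  have e2 : ∀ z, G z * φ (x - z) = ∫ u, h u * k (z - u) * φ (x - z) := fun z ↦ by
    rw [hG, convolution_def, ← integral_mul_const]
    simp only [ContinuousLinearMap.mul_apply']
  simp_rw [e2]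
  -- Fubini
  have hF : Integrable (Function.uncurry fun z u ↦ h u * k (z - u) * φ (x - z))
      (volume.prod volume) := by
    have h1 : Integrable (fun p : ℝ × ℝ ↦ h p.2 * k (p.1 - p.2)) (volume.prod volume) := by
      simpa only [ContinuousLinearMap.mul_apply'] using
        hhi.convolution_integrand (ContinuousLinearMap.mul ℂ ℂ) hk
    exact h1.mul_bdd (c := C) ((hφm.comp (measurable_const.sub measurable_fst)).aestronglyMeasurable)
      (ae_of_all _ fun p ↦ hC _)
  rw [integral_integral_swap hF]
  -- the inner integral is `h(u) · ∫ k((x − u) − y) φ(y) dy = 0`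
  have e3 : ∀ u, ∫ z, h u * k (z - u) * φ (x - z) = 0 := by
    intro u
    simp_rw [mul_assoc]
    rw [integral_const_mul]
    have e4 : ∫ z, k (z - u) * φ (x - z) = 0 := by
      rw [← integral_sub_left_eq_self (fun z ↦ k (z - u) * φ (x - z)) volume x]
      simp only [sub_sub_cancel]
      have e5 : (fun y ↦ k (x - y - u) * φ y) = fun y ↦ k (x - u - y) * φ y := by
        funext y
        ring_nf
      rw [e5]
      exact hφ (x - u)
    rw [e4, mul_zero]
  simp_rw [e3]
  simp

/-- The same with the band-limited function itself: `∫ (𝓕⁻ψ)(y) φ(y) dy = 0`. [cite: Salem1953, Théorème (the Wiener step)] -/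
theorem integral_fourierInv_mul_eq_zero {k : ℝ → ℂ} (hk : Integrable k) (hkc : Continuous k)
    (hkb : ∃ B : ℝ, ∀ u, ‖k u‖ ≤ B) (hks : ContDiff ℝ ∞ (𝓕 k)) (hk0 : ∀ ξ, 𝓕 k ξ ≠ 0)
    {φ : ℝ → ℂ} (hφm : Measurable φ) (hφb : ∃ C : ℝ, ∀ y, ‖φ y‖ ≤ C)
    (hφ : ∀ x : ℝ, ∫ y : ℝ, k (x - y) * φ y = 0)
    {ψ : ℝ → ℂ} (hψ : ContDiff ℝ ∞ ψ) (hψc : HasCompactSupport ψ) :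
    ∫ y : ℝ, 𝓕⁻ ψ y * φ y = 0 := by
  have hψn : ContDiff ℝ ∞ (fun ξ : ℝ ↦ ψ (-ξ)) := hψ.comp contDiff_neg
  have hψnc : HasCompactSupport (fun ξ : ℝ ↦ ψ (-ξ)) := hψc.comp_homeomorph (Homeomorph.neg ℝ)
  have h0 := integral_fourierInv_sub_mul_eq_zero hk hkc hkb hks hk0 hφm hφb hφ hψn hψnc 0
  have e : ∀ y : ℝ, 𝓕⁻ (fun ξ : ℝ ↦ ψ (-ξ)) (0 - y) = 𝓕⁻ ψ y := fun y ↦ by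
    rw [zero_sub, Real.fourierInv_eq_fourier_neg, neg_neg, ← Real.fourierInv_eq_fourier_comp_neg]
  simp_rw [e] at h0
  exact h0

end SalemNecessity

/-! ## §5 Salem's criterion -/

open SalemNecessity in
/-- **Salem's criterion, direction "⟹" (PROVED):** under the Riemann hypothesis, for `1/2 < σ < 1`
every bounded measurable solution of `∫_ℝ e^{−σy} φ(y) dy/(e^{e^{x−y}}+1) = 0` vanishes a.e. — the
Fourier transform `Γ(s)(1−2^{1−s})ζ(s)` (`s = σ − 2πiξ`) of the kernel has no real zero, and the
Wiener step applies. [cite: Salem1953, Théorème (MR 14,727a); Broughan2017, Vol. 2 §8.4 pp. 139–142] -/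
theorem Salem1953_criterion.mp_holds (hRH : RiemannHypothesis) {σ : ℝ} (hσ : 1 / 2 < σ)
    (hσ1 : σ < 1) {φ : ℝ → ℂ} (hφ : IsSalemSolution σ φ) : φ =ᵐ[volume] 0 := by
  have hσ0 : 0 < σ := by linarith
  refine ae_eq_zero_of_forall_bandlimited hφ.1 hφ.2.1 fun ψ hψ hψc ↦ ?_
  refine integral_fourierInv_mul_eq_zero (integrable_salemK hσ0 hσ1) (continuous_salemK σ)
    ⟨1, fun u ↦ ?_⟩ (contDiff_fourier_salemK hσ0 hσ1) (fourier_salemK_ne_zero hRH hσ hσ1) hφ.1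
    hφ.2.1 (fun x ↦ integral_salemK_sub_mul_eq_zero hφ x) hψ hψc
  rw [Complex.norm_real, Real.norm_of_nonneg (salemKernel_pos σ 0 (-u)).le]
  exact salemKernel_zero_neg_le_one hσ0.le hσ1.le u

/-- **Salem's criterion PROVED as an equivalence** — discharge of the named fact `Salem1953_criterion`
(R. Salem 1953; Broughan Vol. 2 §8.4): RH holds iff for every `σ ∈ (1/2, 1)` the integral equation
`∫_ℝ e^{−σy} φ(y) dy/(e^{e^{x−y}}+1) = 0` has no bounded measurable solution other than `φ = 0` a.e.
[cite: Salem1953, Théorème (MR 14,727a); Broughan2017, Vol. 2 §8.4 pp. 139–142] -/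
theorem Salem1953_criterion_holds : Salem1953_criterion :=
  ⟨fun hRH _ hσ hσ1 _ hφ ↦ Salem1953_criterion.mp_holds hRH hσ hσ1 hφ,
    Salem1953_criterion.mpr_holds⟩

end Literature.NumberTheory.LFunctions

end
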